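import Summits.QuantumFields.BalabanUV.Beta.SpineRootedBmNReduced
import Summits.QuantumFields.BalabanUV.Beta.RelInvBorderedHessianStep

/-!
# `hR` FOR THE NATIVE BLOCK-MEAN-DRESSED SPINE WITH THE RELATIVE-INVERSE RULES DISCHARGED AT EVERY STEP —
# `axisReflectionCovariant_flipK_TbalOf_JsBalBmNAtOf_ctrC_relInv` = `…_ctrC_candidate` (p206712) with its hypotheses `h3S`/`h4S`
# (rules 3–4 of `RelInv` for the candidate step Hessian `bhKStepAt 3 ρ_c Lc (j+1)`) SUPPLIED by
# `BorderedHessian.relInv_coDressKBmAt_KInvStep_succ_bhKStepAt` (β sub-cell, row BETA-an2 = BINDER-OWNERS row D1, gen 15; leaf (L1) CLOSED)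

HONEST FRAMING (cell charter, verbatim): «discharging BetaPertH makes Balaban's UV stability UNCONDITIONAL — a real
constructive-QFT result; it is NOT the continuum limit and NOT the Clay problem.»  DERIVED cell leaf (pub-balaban β sub-cell, lane
an2 gen 15); no statement of Bałaban's papers is typed here, no `[cite:]` tag, no `Prop` fact; it instantiates no binder of the
β-function wall by itself.  After this file the REMAINING hypotheses of hR for the ♮-spine are EXACTLY: the data (L0) (`W` tables with
block-translation covariance; the contact coefficients `γ, c` with their three normalisations), (L2) the Wilson ff-law at `j = 0` (`hWff`;
an3's `WilsonReflectionContact.wilsonA_bref`, kernel-done, in the courier chain), (L3) the value-function ff-laws at `j ≥ 1` (`hE3ff`,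
statement-level), (L4) the second-order tables' conjugated law (`X₂`, `hX₂`, `hEX₂`, `hWrC`; external supplier).  Discharges nothing of the
wall by itself; hR is one of four proof-route binders of `OneStepKernelFamily.d1Drift_of_D1Tel_D1Rep`.  NOT `BetaPertH`; NOT continuum;
NOT Clay.  All declarations `[folklore]`; axioms standard.  Provenance: b2b-balaban β sub-cell, unit beta-an2 gen 15, 2026-08-20 (v1); over
`SpineRootedBmNReduced` (p206712) and `RelInvBorderedHessianStep` BY NAME; no existing file touched.
-/

open Finset
open scoped BigOperators
open Literature.MathematicalPhysics.QuantumFieldTheory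
open Literature.MathematicalPhysics.QuantumFieldTheory.Balaban1983to89
open Literature.MathematicalPhysics.QuantumFieldTheory.Balaban1983to89.Beta
open B12Sec2to5 (l1 l1_nonneg)
open ExpKernelCalculus (MKer Decays BiLoc comp tr VertexFamily VertexFamily₂ shiftK)
open AffineAveraging (Form1 Form2 box toSite)
open AveragingContoursRooted (ctr ctrOff ctrOff_mem_box)
open StepJetData (wilsonA)
open PolarizationSign (reflSign AxisReflectionCovariant)
open KernelReflection (refK)
open ResolventReflection (bref Φ)
open OneStepResolventKernel (Fib LocStencil JetData)
open OneStepKernelFamily (KInvStep vertexOfK TbalOf flipK)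
open BalabanStepJetsSucc (wE wVH)
open Summit.QuantumFields.BalabanUV.Beta.TameKernelCalculus
open Summit.QuantumFields.BalabanUV.Beta.ChartConjugation (conjV conjW)
open Summit.QuantumFields.BalabanUV.Beta.ChartConjugationRelative (RelInv)
open Summit.QuantumFields.BalabanUV.Beta.AxialDressingRooted (coDressKBmAt axEc one_le_of_neZero)
open Summit.QuantumFields.BalabanUV.Beta.BorderedHessian (bhKAt diagK ctGen cCT comp_axEc_diagK_comm locStencil_smul_diagK_ctGen spr_bhKAt
  relInv_coDressKBmAt_KInvStep_zero_bhKAt bhKStepAt stepScale stepScale_ne_zero bhKStepAt_succ_fm bhKStepAt_succ_mf bhKStepAt_succ_mm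
  spr_bhKStepAt)

open Summit.QuantumFields.BalabanUV.Beta.BorderedHessian (relInv_coDressKBmAt_KInvStep_succ_bhKStepAt)

namespace Summit.QuantumFields.BalabanUV.Beta.SpineRooted

noncomputable section

/-- [folklore] **`hR` FOR THE NATIVE BLOCK-MEAN-DRESSED SPINE, RULES 3–4 DISCHARGED AT EVERY STEP**: `…_ctrC_candidate` with `h3S`/`h4S`
supplied by `BorderedHessian.relInv_coDressKBmAt_KInvStep_succ_bhKStepAt` (rules `AME`/`EMA` of `RelInv`).  Remaining hypotheses: data (L0),
the Wilson ff-law (L2), the value-function ff-laws (L3), the second-order law (L4).  Discharges nothing of the wall by itself. -/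
theorem axisReflectionCovariant_flipK_TbalOf_JsBalBmNAtOf_ctrC_relInv {Lc : ℕ} [NeZero Lc] (hLc : Odd Lc) (cE cVH cΛ : ℝ)
    (W : ℕ → Fin 4 → (Fin 4 → ℤ) → Fin 4 → (Fin 4 → ℤ) → MKer 4 (Fib 3)) (Cw δw : ℕ → ℝ) (hδw : ∀ j, 0 < δw j)
    (hW : ∀ j, VertexFamily₂ (W j) Lc (Cw j) (δw j))
    (hWt : ∀ (j : ℕ) (μ : Fin 4) (y : Fin 4 → ℤ) (ν : Fin 4) (y' t : Fin 4 → ℤ),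
      W j μ (y + t) ν (y' + t) = shiftK (-((Lc : ℤ) • t)) (W j μ y ν y'))
    (γ : ℕ → ℝ) (hγ0 : γ 0 = cVH / (Lc : ℝ) ^ 4)
    (hγS : ∀ j, γ (j + 1) = cVH * wVH 3 Lc (j + 1) / (stepScale 3 Lc (j + 1) * (Lc : ℝ) ^ 4))
    (C : ℕ → Fin 4 → Fin 4 → (Fin 4 → ℤ) → MKer 4 (Fib 3)) (hCdef : ∀ j α κ' u, C j α κ' u = γ j • diagK (ctGen 3 α Lc κ' u))
    (c : ℕ → ℝ) (hc0 : cE * c 0 = γ 0) (hcS : ∀ j, cE * wE 3 Lc (j + 1) * c (j + 1) = γ (j + 1))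
    (hWff : ∀ (α κ' : Fin 4) (u x z : Fin 4 → ℤ) (a b : Fin 4),
      wilsonA 3 κ' (bref α κ' u) x z (Sum.inl a) (Sum.inl b) =
        reflSign α κ' * ((Φ Lc α).s (Sum.inl a) * (Φ Lc α).s (Sum.inl b) *
          (wilsonA 3 κ' u ((Φ Lc α).r (Sum.inl a) x) ((Φ Lc α).r (Sum.inl b) z) (Sum.inl a) (Sum.inl b) +
            c 0 * conjV (bhKAt 3 (toSite (ctrOff 4 Lc)) Lc) (diagK (ctGen 3 α Lc κ' u))
              ((Φ Lc α).r (Sum.inl a) x) ((Φ Lc α).r (Sum.inl b) z) (Sum.inl a) (Sum.inl b))))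
    (hE3ff : ∀ (j : ℕ) (α κ' : Fin 4) (u x z : Fin 4 → ℤ) (a b : Fin 4),
      e3NAtOf 3 Lc (toSite (ctrOff 4 Lc)) cE cVH cΛ (j + 1) κ' (bref α κ' u) x z (Sum.inl a) (Sum.inl b) =
        reflSign α κ' * ((Φ Lc α).s (Sum.inl a) * (Φ Lc α).s (Sum.inl b) *
          (e3NAtOf 3 Lc (toSite (ctrOff 4 Lc)) cE cVH cΛ (j + 1) κ' u ((Φ Lc α).r (Sum.inl a) x) ((Φ Lc α).r (Sum.inl b) z)
              (Sum.inl a) (Sum.inl b) +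
            c (j + 1) * conjV (bhKStepAt 3 (toSite (ctrOff 4 Lc)) Lc (j + 1)) (diagK (ctGen 3 α Lc κ' u))
              ((Φ Lc α).r (Sum.inl a) x) ((Φ Lc α).r (Sum.inl b) z) (Sum.inl a) (Sum.inl b))))
    (X₂ : ℕ → Fin 4 → Fin 4 → (Fin 4 → ℤ) → Fin 4 → (Fin 4 → ℤ) → MKer 4 (Fib 3)) (hX₂ : ∀ j α μ y ν y', Loc (X₂ j α μ y ν y'))
    (hEX₂ : ∀ j α μ y ν y', comp (axEc (toSite (ctrOff 4 Lc)) Lc) (X₂ j α μ y ν y') = comp (X₂ j α μ y ν y') (axEc (toSite (ctrOff 4 Lc)) Lc))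
    (hWrC : ∀ (j : ℕ) (α μ : Fin 4) (y : Fin 4 → ℤ) (ν : Fin 4) (y' : Fin 4 → ℤ),
      (JsBal0NAtOf (d := 3) hLc.pos (ctrOff_mem_box hLc.pos) cE cVH cΛ W Cw δw hδw hW j).W μ (bref α μ y) ν (bref α ν y') =
        (reflSign α μ * reflSign α ν) • refK (Φ Lc α)
          ((JsBal0NAtOf (d := 3) hLc.pos (ctrOff_mem_box hLc.pos) cE cVH cΛ W Cw δw hδw hW j).W μ y ν y' +
            conjW (bhKStepAt 3 (toSite (ctrOff 4 Lc)) Lc j)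
              (vertexOfK (coDressKBmAt (toSite (ctrOff 4 Lc)) Lc (KInvStep (d := 3) Lc j)) Lc
                (JsBal0NAtOf (d := 3) hLc.pos (ctrOff_mem_box hLc.pos) cE cVH cΛ W Cw δw hδw hW j).S μ y)
              (vertexOfK (coDressKBmAt (toSite (ctrOff 4 Lc)) Lc (KInvStep (d := 3) Lc j)) Lc
                (JsBal0NAtOf (d := 3) hLc.pos (ctrOff_mem_box hLc.pos) cE cVH cΛ W Cw δw hδw hW j).S ν y')
              (vertexOfK (coDressKBmAt (toSite (ctrOff 4 Lc)) Lc (KInvStep (d := 3) Lc j)) Lc (C j α) μ y)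
              (vertexOfK (coDressKBmAt (toSite (ctrOff 4 Lc)) Lc (KInvStep (d := 3) Lc j)) Lc (C j α) ν y') (X₂ j α μ y ν y'))) :
    ∀ j : ℕ, AxisReflectionCovariant
      (flipK (TbalOf Lc (JsBalBmNAtOf (d := 3) hLc.pos (ctrOff_mem_box hLc.pos) cE cVH cΛ W Cw δw hδw hW) j)) :=
  axisReflectionCovariant_flipK_TbalOf_JsBalBmNAtOf_ctrC_candidate hLc cE cVH cΛ W Cw δw hδw hW hWt
    (fun j => (relInv_coDressKBmAt_KInvStep_succ_bhKStepAt (d := 3) (ctrOff_mem_box (one_le_of_neZero Lc)) j).AME)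
    (fun j => (relInv_coDressKBmAt_KInvStep_succ_bhKStepAt (d := 3) (ctrOff_mem_box (one_le_of_neZero Lc)) j).EMA)
    γ hγ0 hγS C hCdef c hc0 hcS hWff hE3ff X₂ hX₂ hEX₂ hWrC

end

end Summit.QuantumFields.BalabanUV.Beta.SpineRooted
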